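import Summits.BirchSwinnertonDyer.BirchSwinnertonDyer.Theorems.KolyvaginRoadThreeZhangSupplyLocalConjOrdinary
import Summits.BirchSwinnertonDyer.BirchSwinnertonDyer.Theorems.KolyvaginRoadThreeMethod2TransverseStrict
import Summits.BirchSwinnertonDyer.Rank1Residual.X11b.RingClassFieldConj
import Literature.NumberTheory.EllipticCurves.HeegnerPointsKolyvaginProp81InertiaProofs
import Literature.NumberTheory.EllipticCurves.HeegnerPointsKolyvaginConjugation
import Literature.NumberTheory.GaloisRepresentations.FrobeniusPlaces
import HarnessLib

/-!
# Route `KolyvaginRoadThree`, deciding crux `ZhangSharpFrameAtThreeHL` (item stmt-BirchSwinnertonDyer-19574):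
# (Stab) — the relaxed group `G(n, ℓ, T)` of the (Supply) binder is stable under complex conjugation; the TRANSVERSE
# local condition at an inert Kolyvagin place transports under `conjAct`
# (cell `bsd-stepL`, ACCEL seat `bsd-stepL-koly3b` g5; `--supports stmt-BirchSwinnertonDyer-19574`, helper; part X of
# the `KolyvaginRoadThreeZhangSupply*` series; discharges the binder `hstab` of part IX-b `supply_signed_of_jump_good`)

HONEST FRAMING. Theorems only; 0 definitions, 0 named facts, 0 `sorry`; closes nothing (T7). PARTITION: O2@3 (B10) ×
A1 × crux 19574 × the S2-ENGINE's (Supply) binder — proves-glue (Galois bookkeeping).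

WHAT. §1 Lifts of the complex conjugation `c` of an imaginary quadratic `K` to `K̄` of the shape `t = e h e⁻¹`,
`h ∈ Γ_ℚ` (`absGaloisTransport`): any `h` outside the image of `Γ_K` gives a lift (`isLiftOfAut_absGaloisTransport_of_
not_mem_range`), and above an INERT rational prime `ℓ` every prime `𝔔 ∣ (ℓ)` of `ℤ̄_K` admits such an `h` STABILISING
`𝔓₀ = 𝔔 ∩ ℤ̄` (`exists_lift_mem_stabilizer_of_inert`: move a complex conjugation `c₀` by the transitivity of `Γ_K` on
the primes above the unique place over `ℓ` — Neukirch I (9.1)). §2 Conjugation `d ↦ t⁻¹ d t` (`IsLiftOfAut.conjGalCMH`)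
by such a lift preserves the decomposition group `D_𝔔` (the tree's `InertiaLift` transport, now for the stabiliser),
the ring-class stabiliser `Gal(K̄/K[ℓ])` (`K[ℓ]/ℚ` is Galois: `RingClassConj.exists_algEquiv_forall_apply_eq`) and
`Gal(K̄/K(E[n]))` (for ANY lift — the tree's version asks the lift to be involutive). §3 Hence zhang3-p1's TRANSVERSE
condition `Method2.transverseLocalKer W K ι ℓ v` at the place `v` of an inert `ℓ` transports under `conjAct c`
(`conjAct_mem_transverseLocalKer`, via `IsLiftOfAut.h1Eval_conjAct`: `[c_* x, d] = t [x, t⁻¹ d t]`). §4 With the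
tree's Kummer transport (`conjAct_mem_selmerLocalKer_iff` along `galAdicCompletionEquiv`; complex places carry no
condition) and part VIII's ordinary transport (`conjAct_mem_ordinaryLocalKer_adicCompletion_iff`), the relaxed group
`G(n, ℓ, T)` — E's Kummer condition at `∞` and at the finite `v ≠ λ` off `T` above no prime of `n`, ORDINARY above
`n`, TRANSVERSE on `T`, free at `λ` — is `conjAct c`-stable: the binder `hstab` of `supply_signed_of_jump_good`
VERBATIM (`conjAct_mem_relaxedGroup`), for `K` imaginary quadratic and `c ≠ 1`.

References: [cite: GrossLMS1991, §3 (K_n Galois over ℚ; τ), §5 (5.1)] [cite: WZhang2014, §8.1 (H¹_tr)]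
[cite: NeukirchANT1999, Ch. I §9 (9.1)] [cite: CasselsFrohlichANT1967, Ch. VII §1.1].
-/

noncomputable section

open scoped Classical Pointwise

namespace Summit.BirchSwinnertonDyer.Rank1Residual.X11b.Three.Koly.ZhangSupply.LocalConj

open WeierstrassCurve NumberField IsDedekindDomain Field
  Literature.NumberTheory.EllipticCurves Literature.NumberTheory.GaloisRepresentations
  Literature.NumberTheory.Automorphic
open Summit.BirchSwinnertonDyer.Rank1Residual.X11b

/-! ## §1 Lifts `e h e⁻¹` of complex conjugation stabilising a prime of `ℤ̄_K` above an inert prime -/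

section Lifts

variable {K : Type} [Field K] [NumberField K]

/-- **An element of `Γ_ℚ` outside the image of `Γ_K` lifts the complex conjugation** of the imaginary quadratic `K`:
`Aut(K/ℚ) = {1, c}` and the restriction of `e h e⁻¹` to `K` is not `1`. [cite: GrossLMS1991, §3 (τ)] -/
theorem isLiftOfAut_absGaloisTransport_of_not_mem_range (hK : IsImaginaryQuadratic K) {c : K ≃ₐ[ℚ] K} (hc : c ≠ 1)
    {h : absoluteGaloisGroup ℚ} (hh : h ∉ Set.range (absGaloisRestrict ℚ K)) :
    IsLiftOfAut c (absGaloisTransport (K := ℚ) (L := K) h).toRingEquiv := by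
  haveI : Algebra.IsQuadraticExtension ℚ K := ⟨hK.1⟩
  have hcard : Nat.card (K ≃ₐ[ℚ] K) = 2 := by rw [IsGalois.card_aut_eq_finrank, hK.1]
  obtain ⟨y, -, hy⟩ := (Nat.card_eq_two_iff' (1 : K ≃ₐ[ℚ] K)).mp hcard
  have hne : (absGaloisTransport (K := ℚ) (L := K) h).restrictNormal K ≠ 1 := by
    intro h1
    apply hh
    rw [mem_range_absGaloisRestrict_iff]
    intro x
    have hx := AlgEquiv.restrictNormal_commutes (absGaloisTransport (K := ℚ) (L := K) h) K x
    rw [h1, AlgEquiv.one_apply] at hx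
    exact hx.symm
  rw [hy c hc, ← hy _ hne]
  exact RatClosure.isLiftOfAut_restrictNormal_absGaloisTransport h

-- the pointwise action of `Γ_ℚ` on the ideals of `ℤ̄` is slow to synthesise
set_option synthInstance.maxHeartbeats 200000 in
/-- **Above an inert prime every prime of `ℤ̄_K` is stabilised by a lift of complex conjugation.** `K` imaginary
quadratic with complex conjugation `c`, `ℓ` a rational prime with `(ℓ)` prime in `𝓞 K`, `v ∋ ℓ` its place and
`𝔔 ∣ v` a prime of `ℤ̄_K`: some `h ∈ Γ_ℚ` stabilises `𝔓₀ = 𝔔 ∩ ℤ̄` and restricts to `c` on `K`. Proof: a complex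
conjugation `c₀` moves `𝔓₀` to a prime above the SAME place `v` (the only one above `ℓ`), which `Γ_K` moves back
(transitivity, Neukirch I (9.1)); `h = (res δ)⁻¹ c₀`. [cite: NeukirchANT1999, Ch. I §9 (9.1)] -/
theorem exists_lift_mem_stabilizer_of_inert (hK : IsImaginaryQuadratic K) {c : K ≃ₐ[ℚ] K} (hc : c ≠ 1) {ℓ : ℕ}
    (hℓ : ℓ.Prime) (hprime : (Ideal.span {(ℓ : 𝓞 K)}).IsPrime) {v : HeightOneSpectrum (𝓞 K)}
    (hv : (ℓ : 𝓞 K) ∈ v.asIdeal) {𝔔 : Ideal (absIntegers (𝓞 K) K)} (h𝔔 : 𝔔 ∈ v.primesAbove) :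
    ∃ h : absoluteGaloisGroup ℚ, h • 𝔔.comap (absIntegersMap ℚ K) = 𝔔.comap (absIntegersMap ℚ K) ∧
      IsLiftOfAut c (absGaloisTransport (K := ℚ) (L := K) h).toRingEquiv := by
  haveI : IsTotallyComplex K := hK.2
  -- a complex conjugation `c₀ ∈ Γ_ℚ`, outside the image of `Γ_K`
  obtain ⟨c₀, hc₀⟩ := exists_isComplexConjugation (Rat.castHom ℝ)
  have hc₀r : c₀ ∉ Set.range (absGaloisRestrict ℚ K) :=
    hc₀.not_mem_range_absGaloisRestrict IsTotallyComplex.isComplex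
  -- the place of `ℚ` below `v` and the prime `𝔓₀ = 𝔔 ∩ ℤ̄`
  set vQ : HeightOneSpectrum (𝓞 ℚ) := v.under (𝓞 ℚ) with hvQ
  have hvv : v.asIdeal.under (𝓞 ℚ) = vQ.asIdeal := rfl
  have h𝔓₀ : 𝔔.comap (absIntegersMap ℚ K) ∈ vQ.primesAbove := comap_absIntegersMap_mem_primesAbove hvv h𝔔
  -- `c₀ • 𝔓₀` lies below a prime `𝔔'` of `ℤ̄_K` above a place `w` over `vQ`; `w = v` by inertness
  obtain ⟨𝔔', w, h𝔔', hw, h𝔔'w⟩ := exists_place_comap_eq_smul (M := K) h𝔓₀ c₀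
  have hℓw : (ℓ : 𝓞 K) ∈ w.asIdeal := by
    have h1 : (ℓ : 𝓞 ℚ) ∈ vQ.asIdeal := by
      rw [← hvv, Ideal.under_def, Ideal.mem_comap, map_natCast]; exact hv
    rw [← hw, Ideal.under_def, Ideal.mem_comap, map_natCast] at h1
    exact h1
  have hwv : w = v := by
    have key : ∀ u : HeightOneSpectrum (𝓞 K), (ℓ : 𝓞 K) ∈ u.asIdeal → u.asIdeal = Ideal.span {(ℓ : 𝓞 K)} := by
      intro u hu
      have hle : Ideal.span {(ℓ : 𝓞 K)} ≤ u.asIdeal := by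
        rw [Ideal.span_le, Set.singleton_subset_iff]; exact hu
      have hne : Ideal.span {(ℓ : 𝓞 K)} ≠ ⊥ := by
        rw [Ne, Ideal.span_singleton_eq_bot]; exact_mod_cast hℓ.ne_zero
      exact ((hprime.isMaximal hne).eq_of_le u.isPrime.ne_top hle).symm
    exact HeightOneSpectrum.ext (by rw [key w hℓw, key v hv])
  subst hwv
  -- transitivity of `Γ_K` on the primes above `w`
  obtain ⟨δ, hδ⟩ := HeightOneSpectrum.exists_smul_eq_of_mem_primesAbove_holds h𝔔 h𝔔'w
  refine ⟨(absGaloisRestrict ℚ K δ)⁻¹ * c₀, ?_, ?_⟩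
  · rw [mul_smul, ← h𝔔', ← hδ, comap_absIntegersMap_smul ℚ K δ 𝔔, inv_smul_smul]
  · refine isLiftOfAut_absGaloisTransport_of_not_mem_range hK hc fun ⟨ε, hε⟩ ↦ hc₀r ⟨δ * ε, ?_⟩
    rw [map_mul, hε, ← mul_assoc, mul_inv_cancel, one_mul]

end Lifts

/-! ## §2 Conjugation by a lift preserves `D_𝔔`, `Gal(K̄/K[ℓ])`, `Gal(K̄/K(E[n]))` -/

section Conj

variable {K : Type} [Field K] [NumberField K]

set_option synthInstance.maxHeartbeats 200000 in
/-- **Conjugation by the lift preserves the decomposition group.** Let `t = e h e⁻¹` lift `c ∈ Aut(K/ℚ)` with `h`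
stabilising `𝔓₀ = 𝔔 ∩ ℤ̄`. Then `t⁻¹ d t ∈ D_𝔔` for `d ∈ D_𝔔`: on `ℤ̄_K`, `t⁻¹ d t (y) = T⁻¹(d(T y))` with the
transport `T = ι ∘ h ∘ ι⁻¹` of the tree's `InertiaLift`, and `T`, `d`, `T⁻¹` all map `𝔔` into `𝔔`; equality of
`t⁻¹ d t • 𝔔` and `𝔔` from the same inclusion for `d⁻¹`. [cite: NeukirchANT1999, Ch. I §9] -/
theorem conjGalCMH_mem_decompositionSubgroup {c : K ≃ₐ[ℚ] K} {h : absoluteGaloisGroup ℚ}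
    (ht : IsLiftOfAut c (absGaloisTransport (K := ℚ) (L := K) h).toRingEquiv) {𝔔 : Ideal (absIntegers (𝓞 K) K)}
    (hh : h • 𝔔.comap (absIntegersMap ℚ K) = 𝔔.comap (absIntegersMap ℚ K)) {d : absoluteGaloisGroup K}
    (hd : d ∈ 𝔔.decompositionSubgroup (absoluteGaloisGroup K)) :
    ht.conjGalCMH d ∈ 𝔔.decompositionSubgroup (absoluteGaloisGroup K) := by
  have hh' : h ∈ MulAction.stabilizer (absoluteGaloisGroup ℚ) (𝔔.comap (absIntegersMap ℚ K)) := hh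
  -- the inclusion `t⁻¹ σ t • 𝔔 ≤ 𝔔` for every `σ ∈ D_𝔔`
  have key : ∀ σ : absoluteGaloisGroup K, σ ∈ 𝔔.decompositionSubgroup (absoluteGaloisGroup K) →
      ∀ y ∈ 𝔔, ht.conjGalCMH σ • y ∈ 𝔔 := by
    intro σ hσ y hy
    set Ty := absIntegersMap ℚ K (h • (absIntegersEquiv ℚ K).symm y) with hTy
    have hval : ht.conjGalCMH σ • y = absIntegersMap ℚ K (h⁻¹ • (absIntegersEquiv ℚ K).symm (σ • Ty)) := by
      apply Subtype.ext
      rw [integralClosure.coe_smul, InertiaLift.coe_transportIntegers, integralClosure.coe_smul, hTy,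
        InertiaLift.coe_transportIntegers, map_inv]
      change (absGaloisTransport (K := ℚ) (L := K) h).toRingEquiv.symm
          ((show AlgebraicClosure K ≃ₐ[K] AlgebraicClosure K from σ)
            ((absGaloisTransport (K := ℚ) (L := K) h).toRingEquiv (y : AlgebraicClosure K))) = _
      rfl
    rw [hval]
    refine InertiaLift.transportIntegers_mem_of_mem (Subgroup.inv_mem _ hh') ?_
    have hTy𝔔 : Ty ∈ 𝔔 := InertiaLift.transportIntegers_mem_of_mem hh' hy
    have := Ideal.smul_mem_pointwise_smul σ Ty 𝔔 hTy𝔔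
    rwa [(Ideal.mem_decompositionSubgroup_iff).mp hσ] at this
  rw [Ideal.mem_decompositionSubgroup_iff]
  refine le_antisymm (fun y hy ↦ ?_) (fun y hy ↦ ?_)
  · have hz : (ht.conjGalCMH d)⁻¹ • y ∈ 𝔔 := (Ideal.mem_pointwise_smul_iff_inv_smul_mem).mp hy
    have h1 := key d hd _ hz
    rwa [smul_inv_smul] at h1
  · have hinv : (ht.conjGalCMH d)⁻¹ • y ∈ 𝔔 := by
      rw [← map_inv]
      exact key d⁻¹ (Subgroup.inv_mem _ hd) y hy
    exact (Ideal.mem_pointwise_smul_iff_inv_smul_mem).mpr hinv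

/-- **Conjugation by ANY lift of complex conjugation preserves `Gal(K̄/K[ℓ])`** (the ring-class stabiliser
`ringClassStabilizer K ι ℓ ℓ` of zhang3-p1's transverse condition): `K[ℓ]/ℚ` is Galois, so the lift `t` composed
with a `K`-embedding `e : K[ℓ] → K̄` is `e ∘ g` for an automorphism `g` of `K[ℓ]`
(`RingClassConj.exists_algEquiv_forall_apply_eq`). [cite: GrossLMS1991, §3 (K_n is Galois over ℚ)] -/
theorem conjGalCMH_mem_ringClassStabilizer (hK : IsImaginaryQuadratic K) (ι : K →+* ℂ) {ℓ : ℕ} (hℓ : ℓ ≠ 0)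
    {c : K ≃ₐ[ℚ] K} {t : AlgebraicClosure K ≃+* AlgebraicClosure K} (ht : IsLiftOfAut c t)
    {d : absoluteGaloisGroup K} (hd : d ∈ ringClassStabilizer K ι ℓ ℓ) :
    ht.conjGalCMH d ∈ ringClassStabilizer K ι ℓ ℓ := by
  rw [mem_ringClassStabilizer_iff] at hd ⊢
  intro e x hx
  obtain ⟨g, hg⟩ := RingClassConj.exists_algEquiv_forall_apply_eq hK ι hℓ (e : ringClassField K ι ℓ →+* _)
    (t.toRingHom.comp (e : ringClassField K ι ℓ →+* AlgebraicClosure K))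
  change t.symm ((show AlgebraicClosure K ≃ₐ[K] AlgebraicClosure K from d) (t (e x))) = e x
  rw [RingEquiv.symm_apply_eq]
  have h1 : t (e x) = e (g x) := hg x
  rw [h1]
  exact hd e (g x) (g x).2

/-- **Conjugation by ANY lift preserves `Γ_{K(E[n])}`** (the tree's `IsLiftOfAut.conjGalCMH_mem_torsionFixing` asks
the lift to be involutive; injectivity of the lift on points suffices). [folklore] -/
theorem conjGalCMH_mem_torsionFixing_of_lift (W : WeierstrassCurve ℚ) {c : K ≃ₐ[ℚ] K}
    {t : AlgebraicClosure K ≃+* AlgebraicClosure K} (ht : IsLiftOfAut c t) (n : ℤ) {d : absoluteGaloisGroup K}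
    (hd : d ∈ torsionFixing (W.baseChange K) n) : ht.conjGalCMH d ∈ torsionFixing (W.baseChange K) n := by
  refine (mem_torsionFixing_iff _ n).mpr fun P ↦ ?_
  have hinj : Function.Injective (ht.torsionMap W n) := fun P Q hPQ ↦ by
    apply Subtype.ext
    have h := congrArg (fun R : geomTorsion (W.baseChange K) n ↦ (R : geomPoints (W.baseChange K))) hPQ
    simp only [IsLiftOfAut.coe_torsionMap] at h
    exact WeierstrassCurve.Affine.Point.map_injective (W' := W) ht.algEquiv.toAlgHom h
  apply hinj
  rw [ht.torsionMap_smul W n, smul_eq_of_mem_torsionFixing _ n hd]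

end Conj

/-! ## §3 The transverse condition at an inert place transports under `conjAct` -/

section Transverse

variable {K : Type} [Field K] [NumberField K] (W : WeierstrassCurve ℚ)

/-- **The TRANSVERSE condition transports** (one direction): at the place `v` of a rational prime `ℓ` inert in the
imaginary quadratic `K`, if the cocycle of `x ∈ H¹(K, E[3])` vanishes on every `D_𝔓 ∩ Gal(K̄/K[ℓ]) ∩ Gal(K̄/K(E[3]))`,
`𝔓 ∣ v`, so does the cocycle of `c_* x`: `[c_* x, d] = t [x, t⁻¹ d t]` (`IsLiftOfAut.h1Eval_conjAct`) for the lift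
`t = e h e⁻¹` of §1 stabilising `𝔓 ∩ ℤ̄`, and `t⁻¹ d t` lies again in the three subgroups (§2).
[cite: WZhang2014, §8.1 (H¹_tr)] [cite: GrossLMS1991, §5 (5.1)] -/
theorem conjAct_mem_transverseLocalKer_of_mem (hK : IsImaginaryQuadratic K) {c : K ≃ₐ[ℚ] K} (hc : c ≠ 1)
    (ι : K →+* ℂ) {ℓ : ℕ} (hℓ : ℓ.Prime) (hprime : (Ideal.span {(ℓ : 𝓞 K)}).IsPrime)
    {v : HeightOneSpectrum (𝓞 K)} (hv : (ℓ : 𝓞 K) ∈ v.asIdeal) {x : Method2.V3 W K}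
    (hx : x ∈ Method2.transverseLocalKer W K ι ℓ v) :
    conjAct W c ((3 ^ 1 : ℕ) : ℤ) x ∈ Method2.transverseLocalKer W K ι ℓ v := by
  rw [Method2.mem_transverseLocalKer_iff] at hx ⊢
  intro 𝔓 h𝔓 d hdD hdR hdT
  obtain ⟨h, hh, ht⟩ := exists_lift_mem_stabilizer_of_inert hK hc hℓ hprime hv h𝔓
  rw [ht.h1Eval_conjAct W ((3 ^ 1 : ℕ) : ℤ) x hdT,
    hx 𝔓 h𝔓 (ht.conjGalCMH d) (conjGalCMH_mem_decompositionSubgroup ht hh hdD)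
      (conjGalCMH_mem_ringClassStabilizer hK ι hℓ.ne_zero ht hdR) (conjGalCMH_mem_torsionFixing_of_lift W ht _ hdT),
    map_zero]

/-- **The TRANSVERSE condition at an inert place is `conjAct`-invariant**: `c_* x` is transverse at `v ∋ ℓ` iff `x`
is (the converse from `c⁻¹` and `c⁻¹_* c_* = id`). [cite: WZhang2014, §8.1 (H¹_tr)] [cite: GrossLMS1991, §5 (5.1)] -/
theorem conjAct_mem_transverseLocalKer_iff (hK : IsImaginaryQuadratic K) {c : K ≃ₐ[ℚ] K} (hc : c ≠ 1)
    (ι : K →+* ℂ) {ℓ : ℕ} (hℓ : ℓ.Prime) (hprime : (Ideal.span {(ℓ : 𝓞 K)}).IsPrime)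
    {v : HeightOneSpectrum (𝓞 K)} (hv : (ℓ : 𝓞 K) ∈ v.asIdeal) (x : Method2.V3 W K) :
    conjAct W c ((3 ^ 1 : ℕ) : ℤ) x ∈ Method2.transverseLocalKer W K ι ℓ v ↔
      x ∈ Method2.transverseLocalKer W K ι ℓ v := by
  refine ⟨fun h ↦ ?_, conjAct_mem_transverseLocalKer_of_mem W hK hc ι hℓ hprime hv⟩
  have hc' : c⁻¹ ≠ 1 := fun h1 ↦ hc (inv_eq_one.mp h1)
  have h' := conjAct_mem_transverseLocalKer_of_mem W hK hc' ι hℓ hprime hv h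
  rwa [conjAct_inv_conjAct] at h'

end Transverse

/-! ## §4 (Stab): the relaxed group `G(n, ℓ, T)` is stable under complex conjugation -/

section Stab

variable {K : Type} [Field K] [NumberField K] (W : WeierstrassCurve ℚ) [W.IsGloballyMinimal]

/-- **(Stab) — the binder `hstab` of `supply_signed_of_jump_good` DISCHARGED.** For `K` imaginary quadratic with
complex conjugation `c ≠ 1`, the places `plK` of the Kolyvagin primes (`hplK`), a level `n`, a Kolyvagin prime `ℓ`
and a finite set `T` of Kolyvagin primes: if `x ∈ H¹(K, E[3])` satisfies E's Kummer condition at the infinite places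
and at the finite `v ≠ λ` off `T` above no prime of `n`, the ORDINARY condition above `n` (off `λ`, `T`) and the
TRANSVERSE condition on `T`, then so does `c_* x`. Ingredients: complex places carry no condition
(`selmerLocalKer_eq_top_of_isAlgClosed`); Kummer transport `conjAct_mem_selmerLocalKer_iff` along
`galAdicCompletionEquiv c : K_{c⁻¹v} ≃ K_v`; ordinary transport (part VIII); transverse transport (§3); the places of
inert primes are `c`-fixed and «lying above the rational prime `q`» is `c`-invariant. (`GoodLevel`, `Nonempty`,
`ℓ ∉ T` are not used.) [cite: GrossLMS1991, §5 (5.1)] [cite: WZhang2014, §8.1] -/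
theorem conjAct_mem_relaxedGroup (hK : IsImaginaryQuadratic K) {c : K ≃ₐ[ℚ] K} (hc : c ≠ 1) (ι : K →+* ℂ)
    (plK : {ℓ // Zhang2014.IsKolyvaginPrime (W.conductorNorm ℤ) W K 3 ℓ} → HeightOneSpectrum (𝓞 K))
    (hplK : ∀ ℓ, ((ℓ : ℕ) : 𝓞 K) ∈ (plK ℓ).asIdeal) :
    ∀ (n : Finset {q // Method2.IsUAdmissiblePrime W K q}), Method2.GoodLevel W K n → n.Nonempty →
      ∀ (ℓ : {ℓ // Zhang2014.IsKolyvaginPrime (W.conductorNorm ℤ) W K 3 ℓ}) (T : Finset _), ℓ ∉ T →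
      ∀ x : Method2.V3 W K,
        ((∀ w : InfinitePlace K, x ∈ selmerLocalKer (W.baseChange K) w.Completion ((3 ^ 1 : ℕ) : ℤ)) ∧
          (∀ v : HeightOneSpectrum (𝓞 K), v ≠ plK ℓ → (∀ ℓ' ∈ T, plK ℓ' ≠ v) →
            ((∀ q ∈ n, ((q : ℕ) : 𝓞 K) ∉ v.asIdeal) →
              x ∈ selmerLocalKer (W.baseChange K) (v.adicCompletion K) ((3 ^ 1 : ℕ) : ℤ)) ∧
            (∀ q ∈ n, ((q : ℕ) : 𝓞 K) ∈ v.asIdeal →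
              x ∈ (W.baseChange K).ordinaryLocalKer (v.adicCompletion K) ((3 ^ 1 : ℕ) : ℤ))) ∧
          (∀ ℓ' ∈ T, x ∈ Method2.transverseLocalKer W K ι ℓ' (plK ℓ'))) →
        ((∀ w : InfinitePlace K,
            conjAct W c ((3 ^ 1 : ℕ) : ℤ) x ∈ selmerLocalKer (W.baseChange K) w.Completion ((3 ^ 1 : ℕ) : ℤ)) ∧
          (∀ v : HeightOneSpectrum (𝓞 K), v ≠ plK ℓ → (∀ ℓ' ∈ T, plK ℓ' ≠ v) →
            ((∀ q ∈ n, ((q : ℕ) : 𝓞 K) ∉ v.asIdeal) →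
              conjAct W c ((3 ^ 1 : ℕ) : ℤ) x ∈
                selmerLocalKer (W.baseChange K) (v.adicCompletion K) ((3 ^ 1 : ℕ) : ℤ)) ∧
            (∀ q ∈ n, ((q : ℕ) : 𝓞 K) ∈ v.asIdeal →
              conjAct W c ((3 ^ 1 : ℕ) : ℤ) x ∈
                (W.baseChange K).ordinaryLocalKer (v.adicCompletion K) ((3 ^ 1 : ℕ) : ℤ))) ∧
          (∀ ℓ' ∈ T, conjAct W c ((3 ^ 1 : ℕ) : ℤ) x ∈ Method2.transverseLocalKer W K ι ℓ' (plK ℓ'))) := by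
  intro n _ _ ℓ T _ x hx
  haveI : IsTotallyComplex K := hK.2
  -- natural numbers are fixed by `Aut(K/ℚ)`; «`q` lies in `v`» is invariant; inert places are fixed
  have hnat : ∀ (σ : K ≃ₐ[ℚ] K) (v : HeightOneSpectrum (𝓞 K)) (q : ℕ),
      (q : 𝓞 K) ∈ (σ • v).asIdeal ↔ (q : 𝓞 K) ∈ v.asIdeal := by
    intro σ v q
    have hq : σ • (q : 𝓞 K) = (q : 𝓞 K) := map_natCast (MulSemiringAction.toRingHom (K ≃ₐ[ℚ] K) (𝓞 K) σ) q
    rw [← HeightOneSpectrum.smul_mem_smul_asIdeal_iff σ v (q : 𝓞 K), hq]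
  have huniq : ∀ {q : ℕ}, (Ideal.span {(q : 𝓞 K)}).IsPrime → q ≠ 0 → ∀ {v v' : HeightOneSpectrum (𝓞 K)},
      (q : 𝓞 K) ∈ v.asIdeal → (q : 𝓞 K) ∈ v'.asIdeal → v' = v := by
    intro q hq hq0 v v' hv hv'
    have key : ∀ w : HeightOneSpectrum (𝓞 K), (q : 𝓞 K) ∈ w.asIdeal → w.asIdeal = Ideal.span {(q : 𝓞 K)} := by
      intro w hw
      have hle : Ideal.span {(q : 𝓞 K)} ≤ w.asIdeal := by
        rw [Ideal.span_le, Set.singleton_subset_iff]; exact hw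
      have hne : Ideal.span {(q : 𝓞 K)} ≠ ⊥ := by
        rw [Ne, Ideal.span_singleton_eq_bot]; exact_mod_cast hq0
      exact ((hq.isMaximal hne).eq_of_le w.isPrime.ne_top hle).symm
    exact HeightOneSpectrum.ext (by rw [key v hv, key v' hv'])
  have hfix : ∀ (σ : K ≃ₐ[ℚ] K) (ℓ' : {ℓ // Zhang2014.IsKolyvaginPrime (W.conductorNorm ℤ) W K 3 ℓ}),
      σ • plK ℓ' = plK ℓ' := fun σ ℓ' ↦
    huniq ℓ'.2.2.2.2.2.1 ℓ'.2.1.ne_zero (hplK ℓ') ((hnat σ (plK ℓ') ℓ').mpr (hplK ℓ'))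
  refine ⟨fun w ↦ ?_, fun v hv hvT ↦ ?_, fun ℓ' hℓ' ↦ ?_⟩
  · -- complex places carry no condition
    haveI : IsAlgClosed w.Completion :=
      isAlgClosed_of_ringEquiv (InfinitePlace.Completion.ringEquivComplexOfIsComplex (IsTotallyComplex.isComplex w)).symm
    rw [WeierstrassCurve.selmerLocalKer_eq_top_of_isAlgClosed]
    trivial
  · -- finite places off `λ` and `T`: transport from `v₀ = c⁻¹ • v`
    have h0 : c • (c⁻¹ • v) = v := smul_inv_smul c v
    have hv₀ : c⁻¹ • v ≠ plK ℓ := fun h ↦ hv (by rw [← h0, h, hfix])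
    have hv₀T : ∀ ℓ' ∈ T, plK ℓ' ≠ c⁻¹ • v := fun ℓ' hℓ'T h ↦ hvT ℓ' hℓ'T (by rw [← h0, ← h, hfix])
    haveI : CharZero ((c⁻¹ • v).adicCompletion K) := charZero_of_injective_algebraMap (algebraMap K _).injective
    haveI : CharZero (v.adicCompletion K) := charZero_of_injective_algebraMap (algebraMap K _).injective
    obtain ⟨hk, ho⟩ := hx.2.1 (c⁻¹ • v) hv₀ hv₀T
    refine ⟨fun hq ↦ ?_, fun q hq hqv ↦ ?_⟩
    · exact (conjAct_mem_selmerLocalKer_iff W c (galAdicCompletionEquiv (L := K) c h0)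
        (isSemilinearRingEquiv_galAdicCompletionEquiv c h0) _ x).mpr
        (hk fun q hqn hqv ↦ hq q hqn ((hnat c⁻¹ v q).mp hqv))
    · exact (conjAct_mem_ordinaryLocalKer_adicCompletion_iff W c h0 _ x).mpr
        (ho q hq ((hnat c⁻¹ v q).mpr hqv))
  · -- transverse at the places of `T`
    exact conjAct_mem_transverseLocalKer_of_mem W hK hc ι ℓ'.2.1 ℓ'.2.2.2.2.2.1 (hplK ℓ') (hx.2.2 ℓ' hℓ')

end Stab

end Summit.BirchSwinnertonDyer.Rank1Residual.X11b.Three.Koly.ZhangSupply.LocalConj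

end
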